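import Summits.ResolutionOfSingularities.ResolutionOfSingularities.Theorems.FrobeniusLadderFInjectiveMacaulayficationSpreadLocFix
import Summits.ResolutionOfSingularities.ResolutionOfSingularities.Theorems.FrobeniusLadderFInjectiveMacaulayficationFCUnguardedAprime
import Summits.ResolutionOfSingularities.ResolutionOfSingularities.Theorems.FrobeniusLadderFInjectiveMacaulayficationCentreSpread
import Literature.AlgebraicGeometry.Resolution.MarkedIdealsLemmas
import Literature.AlgebraicGeometry.Resolution.KollarBlowupSequenceFunctors
import HarnessLib

/-!
# The DOMINATING (product-compatible) local fix: goodness of a GIVEN centre spreads from the fibre, and `J₀ · J″` cures near `ζ`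
# (crux `FInjectiveMacaulayfication` stmt-ResolutionOfSingularities-15315, chain w45a; res-L1-w45a-plan-1 RULING R16.43 «stub-1's NEXT
# OBJECT = the PRODUCT-COMPATIBLE SEMI-LOCAL CURE … (a) `goodOver_nhd_of_locGood` … (c) `exists_dominating_goodOver_nhd`»; seat res-L1-w45a-stub-1 g6)

[OURS · L1 W4.5a] Support file (`--supports stmt-ResolutionOfSingularities-15315 --as helper`); NOT a statement of any manuscript; def-free;
CONDITIONAL on `NonFullLocusClosed.NonFullLocusClosed` (closedness of the non-FULL locus of an integral variety = Datta–Murayama 2024 Thm. B +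
EGA IV₂ 6.11.2 BY NAME, `NonFullLocusClosed.nonFullLocusClosed_of_named`); AI-written (AI review is weaker than expert review).

WHY (plan-1 R16.43). Every globalisation / cluster-growth scheme for FC″ needs ONE brick nobody had: a cure near a residual point `ζ` that is
COMPATIBLE WITH A GIVEN partial cure `J₀` — i.e. of the form `J₁ := J₀ · J″`, which EQUALS `J₀` wherever `J″` is a unit, so that improving `J₀`
near `ζ` does not disturb it elsewhere; the remaining obstruction to cluster growth is then only the closure of `supp J″` outside the good
neighbourhood, explicit and geometric.

THE THEOREMS (binders: `k` a field of characteristic `p`, `X₁ → Spec k` of finite type, quasi-compact, `X₁` integral).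
* §1 (a) `full_nhd_of_locGood` / `goodOver_nhd_of_locGood (hNF)`: for ANY ideal sheaf `J ≠ ⊥`, any point `ζ` and generators `c` of the stalk
  `J_ζ`, if every prime `𝔔` OVER `𝔪_ζ` of every affine blow-up chart `𝒪_{X₁,ζ}[(c)/c_j]` is FULL, then there is an open `U ∋ ζ` over which
  EVERY blowing up of `X₁` along `J` is FULL at EVERY point — in particular `GoodOver p X₁ J U`. NOTE the hypothesis is over `𝔪_ζ` ONLY:
  fullness over the generizations of `ζ` FOLLOWS (closedness of the non-FULL locus upstairs + properness), exactly as in res-L1-w45a-stub-2's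
  `SpreadLocFix.exists_spread_full_of_locFixData` (same proof, minus the spread: the centre is given). `_of_DM_CMLocusOpen`: the same from
  the two printed openness theorems BY NAME.
* §2 (c) `exists_dominating_goodOver_nhd (hNF)`: given `J₀ ≠ ⊥`, a point `ζ`, germs `c` at `ζ` with `(c) ≠ ⊥`, and generators `d` of the
  PRODUCT `J₀,ζ · (c)` all of whose affine blow-up charts are FULL at the primes over `𝔪_ζ`, there are an ideal sheaf `J″ ≠ ⊥` with
  `J″_ζ = (c)` and an open `U ∋ ζ` with `GoodOver p X₁ (J₀ * J″) U` (indeed every blowing up along `J₀ · J″` FULL over `U`). Proof: spread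
  `(c)` to `J″` (`CentreSpread.centreSpread`; `J″ := ⊤` if `(c) = ⊤`), `(J₀ · J″)_ζ = J₀,ζ · (c) = (d)` (`stalkIdeal_mul`), and (a). DEF-FREE:
  the local hypothesis of (c) is exactly what R16.43 (b) (`exists_productCompatible_locFix_lowDim`: a product-compatible REGULAR local
  blow-up at `ζ` of local dimension `≤ 3`, from Cossart–Piltant + Raynaud–Gruson + CP principalization) is to supply.
[cite: DattaMurayama2024, Thm. B] [cite: StacksProject, Tag 0804] [cite: GortzWedhorn2020, Prop. 13.91 and 13.96]
-/

-- single-problem summit: the doubled namespace component is forced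
set_option linter.dupNamespace false

noncomputable section

namespace Summit.ResolutionOfSingularities.ResolutionOfSingularities.Theorems.FInjectiveMacaulayfication.DominatingLocFix

open CategoryTheory AlgebraicGeometry TopologicalSpace IsLocalRing
open Literature.AlgebraicGeometry.Resolution
open Summit.ResolutionOfSingularities.ResolutionOfSingularities.Theorems.FInjectiveMacaulayfication
open SliceableCentre FCUnguardedAprime

/-! ## §1 (a) Goodness of a GIVEN centre spreads from the fibre over `ζ` -/

/-- **(a) Blowing ups along a GIVEN `J` are FULL over a neighbourhood of `ζ` as soon as the affine blow-up charts of `J_ζ` are FULL over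
`𝔪_ζ`.** Fix one blowing up `π : X₂ → X₁` along `J` (proper, `X₂` integral of finite type); its non-FULL locus `Z` is closed (`hNF`), so is
`B := π(Z)`, and `ζ ∉ B` because a point of `X₂` over `ζ` is a localization of a chart `𝒪_{X₁,ζ}[(c)/c_j]` at a prime over `𝔪_ζ`
(`IsBlowup.exists_blowupAlgebra_stalk_ringEquiv`, Stacks 0804); `U := X₁ ∖ B`; any other blowing up along `J` is `X₂` up to an
`X₁`-isomorphism. [OURS · conditional on `NonFullLocusClosed`] [cite: StacksProject, Tag 0804] -/
theorem full_nhd_of_locGood (hNF : NonFullLocusClosed.NonFullLocusClosed)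
    (p : ℕ) (hp : p.Prime) (k : Type) [Field k] [CharP k p] (X₁ : Scheme.{0}) (f₁ : X₁ ⟶ Spec (.of k))
    [LocallyOfFiniteType f₁] [QuasiCompact f₁] [IsIntegral X₁]
    (J : X₁.IdealSheafData) (hJ : J ≠ ⊥) (ζ : X₁) {n : ℕ} (c : Fin n → X₁.presheaf.stalk ζ)
    (hc : Ideal.span (Set.range c) = stalkIdeal J ζ)
    (hfull : ∀ (j : Fin n) (𝔔 : PrimeSpectrum (blowupAlgebra (Ideal.span (Set.range c)) (c j))),
      𝔔.asIdeal.comap (algebraMap (X₁.presheaf.stalk ζ) (blowupAlgebra (Ideal.span (Set.range c)) (c j))) =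
        maximalIdeal (X₁.presheaf.stalk ζ) → FullCl p (Localization.AtPrime 𝔔.asIdeal)) :
    ∃ U : X₁.Opens, ζ ∈ (U : Set X₁) ∧
      ∀ (X₂ : Scheme.{0}) (π : X₂ ⟶ X₁), IsBlowup π J → ∀ x : X₂, π.base x ∈ (U : Set X₁) → FullCl p (X₂.presheaf.stalk x) := by
  classical
  haveI : Fact p.Prime := ⟨hp⟩
  haveI : IsNoetherian X₁ := ClosedPointsOfClosedFinite.isNoetherian_of_locallyOfFiniteType_of_quasiCompact f₁
  -- ONE blowing up along `J`
  obtain ⟨X₂, π, hπ⟩ := exists_isBlowup X₁ J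
  haveI : IsProper π := hπ.isProper
  haveI : IsIntegral X₂ := hπ.isIntegral hJ
  -- its non-FULL locus is closed (`hNF`), hence so is its image `B`
  have hZ : IsClosed {x : X₂ | ¬ NonFullLocusClosed.Clause p (X₂.presheaf.stalk x)} :=
    hNF p hp k X₂ (π ≫ f₁) inferInstance inferInstance inferInstance
  have hBc : IsClosed (π.base '' {x : X₂ | ¬ NonFullLocusClosed.Clause p (X₂.presheaf.stalk x)}) := π.isClosedMap _ hZ
  -- `ζ ∉ B`: the points over `ζ` are localizations of the charts at primes over `𝔪_ζ`, FULL by hypothesis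
  have hζB : ζ ∉ π.base '' {x : X₂ | ¬ NonFullLocusClosed.Clause p (X₂.presheaf.stalk x)} := by
    rintro ⟨x₂, hx₂, hx₂ζ⟩
    subst hx₂ζ
    obtain ⟨j, 𝔔, χ, e, -, -, -, h𝔔⟩ := hπ.exists_blowupAlgebra_stalk_ringEquiv x₂ c hc
    apply hx₂
    unfold NonFullLocusClosed.Clause
    exact DegreeZeroDescent.inlineClause_of_ringEquiv p e.symm (hfull j 𝔔 h𝔔).2
  refine ⟨⟨_, hBc.isOpen_compl⟩, hζB, ?_⟩
  -- any blowing up along `J` is `X₂` up to an `X₁`-isomorphism, which identifies stalks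
  intro X₂' π' hπ' x' hx'
  obtain ⟨e, he, -⟩ := hπ'.unique hπ
  have hx₂ : π.base (e.hom.base x') = π'.base x' := by
    rw [← Scheme.Hom.comp_apply, he]
  have hgood : NonFullLocusClosed.Clause p (X₂.presheaf.stalk (e.hom.base x')) := by
    by_contra hbad
    exact hx' ⟨e.hom.base x', hbad, hx₂⟩
  unfold NonFullLocusClosed.Clause at hgood
  let ex : X₂.presheaf.stalk (e.hom.base x') ≃+* X₂'.presheaf.stalk x' := (asIso (e.hom.stalkMap x')).commRingCatIsoToRingEquiv
  exact ⟨MulEquiv.isDomain _ ex.symm.toMulEquiv, DegreeZeroDescent.inlineClause_of_ringEquiv p ex hgood⟩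

/-- **(a) `goodOver_nhd_of_locGood`** — the same with the conclusion in the `GoodOver` currency as well: every blowing up along the GIVEN
`J` is FULL at every point over `U ∋ ζ`, in particular FULL at the non-closed and CM at the closed points over `U`.
[OURS · conditional on `NonFullLocusClosed`] -/
theorem goodOver_nhd_of_locGood (hNF : NonFullLocusClosed.NonFullLocusClosed)
    (p : ℕ) (hp : p.Prime) (k : Type) [Field k] [CharP k p] (X₁ : Scheme.{0}) (f₁ : X₁ ⟶ Spec (.of k))
    [LocallyOfFiniteType f₁] [QuasiCompact f₁] [IsIntegral X₁]
    (J : X₁.IdealSheafData) (hJ : J ≠ ⊥) (ζ : X₁) {n : ℕ} (c : Fin n → X₁.presheaf.stalk ζ)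
    (hc : Ideal.span (Set.range c) = stalkIdeal J ζ)
    (hfull : ∀ (j : Fin n) (𝔔 : PrimeSpectrum (blowupAlgebra (Ideal.span (Set.range c)) (c j))),
      𝔔.asIdeal.comap (algebraMap (X₁.presheaf.stalk ζ) (blowupAlgebra (Ideal.span (Set.range c)) (c j))) =
        maximalIdeal (X₁.presheaf.stalk ζ) → FullCl p (Localization.AtPrime 𝔔.asIdeal)) :
    ∃ U : X₁.Opens, ζ ∈ (U : Set X₁) ∧
      (∀ (X₂ : Scheme.{0}) (π : X₂ ⟶ X₁), IsBlowup π J → ∀ x : X₂, π.base x ∈ (U : Set X₁) → FullCl p (X₂.presheaf.stalk x)) ∧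
      GoodOver p X₁ J (U : Set X₁) := by
  obtain ⟨U, hζU, hU⟩ := full_nhd_of_locGood hNF p hp k X₁ f₁ J hJ ζ c hc hfull
  refine ⟨U, hζU, hU, fun X₂ π hπ => ⟨fun x hx _ => hU X₂ π hπ x hx, fun x hx _ => ?_⟩⟩
  obtain ⟨-, hF⟩ := hU X₂ π hπ x hx
  exact fun d hd s hs => (hF d hd s hs).1

/-- (a) from the two printed openness theorems BY NAME: Datta–Murayama 2024 Thm. B (`DattaMurayama2024_fInjectiveLocusOpen`) and openness of
the Cohen–Macaulay locus (`NonFullLocusClosed.CMLocusOpen`, EGA IV₂ 6.11.2). [OURS · conditional-result] [cite: DattaMurayama2024, Thm. B] -/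
theorem goodOver_nhd_of_locGood_of_DM_CMLocusOpen
    (hDM : Literature.AlgebraicGeometry.Resolution.DattaMurayama2024_fInjectiveLocusOpen.{0})
    (hCMo : NonFullLocusClosed.CMLocusOpen)
    (p : ℕ) (hp : p.Prime) (k : Type) [Field k] [CharP k p] (X₁ : Scheme.{0}) (f₁ : X₁ ⟶ Spec (.of k))
    [LocallyOfFiniteType f₁] [QuasiCompact f₁] [IsIntegral X₁]
    (J : X₁.IdealSheafData) (hJ : J ≠ ⊥) (ζ : X₁) {n : ℕ} (c : Fin n → X₁.presheaf.stalk ζ)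
    (hc : Ideal.span (Set.range c) = stalkIdeal J ζ)
    (hfull : ∀ (j : Fin n) (𝔔 : PrimeSpectrum (blowupAlgebra (Ideal.span (Set.range c)) (c j))),
      𝔔.asIdeal.comap (algebraMap (X₁.presheaf.stalk ζ) (blowupAlgebra (Ideal.span (Set.range c)) (c j))) =
        maximalIdeal (X₁.presheaf.stalk ζ) → FullCl p (Localization.AtPrime 𝔔.asIdeal)) :
    ∃ U : X₁.Opens, ζ ∈ (U : Set X₁) ∧
      (∀ (X₂ : Scheme.{0}) (π : X₂ ⟶ X₁), IsBlowup π J → ∀ x : X₂, π.base x ∈ (U : Set X₁) → FullCl p (X₂.presheaf.stalk x)) ∧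
      GoodOver p X₁ J (U : Set X₁) :=
  goodOver_nhd_of_locGood (NonFullLocusClosed.nonFullLocusClosed_of_named hDM hCMo) p hp k X₁ f₁ J hJ ζ c hc hfull

/-! ## §2 (c) The dominating cure `J₀ · J″` near `ζ` -/

/-- **(c) `exists_dominating_goodOver_nhd`** — given a partial cure `J₀ ≠ ⊥`, a point `ζ`, germs `c` with `(c) ≠ ⊥` and generators `d` of the
product `J₀,ζ · (c)` whose affine blow-up charts are FULL at the primes over `𝔪_ζ` (the product-compatible local fix R16.43 (b) is to supply),
there are `J″ ≠ ⊥` with `J″_ζ = (c)` and an open `U ∋ ζ` over which every blowing up along `J₀ · J″` is FULL at every point; in particular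
`GoodOver p X₁ (J₀ * J″) U`. Off `supp J″` the new centre `J₀ · J″` IS `J₀`. [OURS · conditional on `NonFullLocusClosed`] -/
theorem exists_dominating_goodOver_nhd (hNF : NonFullLocusClosed.NonFullLocusClosed)
    (p : ℕ) (hp : p.Prime) (k : Type) [Field k] [CharP k p] (X₁ : Scheme.{0}) (f₁ : X₁ ⟶ Spec (.of k))
    [LocallyOfFiniteType f₁] [QuasiCompact f₁] [IsIntegral X₁]
    (J₀ : X₁.IdealSheafData) (hJ₀ : J₀ ≠ ⊥) (ζ : X₁) {m : ℕ} (c : Fin m → X₁.presheaf.stalk ζ)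
    (hc0 : Ideal.span (Set.range c) ≠ ⊥) {n : ℕ} (d : Fin n → X₁.presheaf.stalk ζ)
    (hd : Ideal.span (Set.range d) = stalkIdeal J₀ ζ * Ideal.span (Set.range c))
    (hfull : ∀ (j : Fin n) (𝔔 : PrimeSpectrum (blowupAlgebra (Ideal.span (Set.range d)) (d j))),
      𝔔.asIdeal.comap (algebraMap (X₁.presheaf.stalk ζ) (blowupAlgebra (Ideal.span (Set.range d)) (d j))) =
        maximalIdeal (X₁.presheaf.stalk ζ) → FullCl p (Localization.AtPrime 𝔔.asIdeal)) :
    ∃ (J'' : X₁.IdealSheafData) (U : X₁.Opens), J'' ≠ ⊥ ∧ stalkIdeal J'' ζ = Ideal.span (Set.range c) ∧ ζ ∈ (U : Set X₁) ∧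
      (∀ (X₂ : Scheme.{0}) (π : X₂ ⟶ X₁), IsBlowup π (J₀ * J'') → ∀ x : X₂, π.base x ∈ (U : Set X₁) → FullCl p (X₂.presheaf.stalk x)) ∧
      GoodOver p X₁ (J₀ * J'') (U : Set X₁) := by
  classical
  haveI : IsNoetherian X₁ := ClosedPointsOfClosedFinite.isNoetherian_of_locallyOfFiniteType_of_quasiCompact f₁
  -- spread `(c)` to an ideal sheaf `J″` (`⊤` if `(c)` is the unit ideal)
  obtain ⟨J'', hJ'', hJ''ζ⟩ : ∃ J'' : X₁.IdealSheafData, J'' ≠ ⊥ ∧ stalkIdeal J'' ζ = Ideal.span (Set.range c) := by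
    by_cases htop : Ideal.span (Set.range c) = ⊤
    · refine ⟨⊤, fun h => ?_, by rw [stalkIdeal_top, htop]⟩
      have h1 : stalkIdeal (⊤ : X₁.IdealSheafData) ζ = stalkIdeal (⊥ : X₁.IdealSheafData) ζ := by rw [h]
      rw [stalkIdeal_top, stalkIdeal_bot] at h1
      have h2 : (1 : X₁.presheaf.stalk ζ) ∈ (⊥ : Ideal (X₁.presheaf.stalk ζ)) := h1 ▸ Submodule.mem_top
      exact one_ne_zero ((Submodule.mem_bot _).mp h2)
    · obtain ⟨J'', hJ'', -, hJ''ζ⟩ := CentreSpread.centreSpread X₁ ζ m c hc0 (le_maximalIdeal htop)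
      exact ⟨J'', hJ'', hJ''ζ⟩
  -- the product is nonzero (stalks at any point of an integral scheme multiply in a domain)
  have hprod : J₀ * J'' ≠ ⊥ := by
    intro h0
    have h1 : stalkIdeal (J₀ * J'') ζ = ⊥ := by rw [h0]; exact stalkIdeal_bot ζ
    rw [stalkIdeal_mul] at h1
    rcases Ideal.mul_eq_bot.mp h1 with h | h
    · exact stalkIdeal_ne_bot_of_ne_bot hJ₀ ζ h
    · exact stalkIdeal_ne_bot_of_ne_bot hJ'' ζ h
  -- `(J₀ · J″)_ζ = J₀,ζ · (c) = (d)`, and (a)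
  have hdζ : Ideal.span (Set.range d) = stalkIdeal (J₀ * J'') ζ := by rw [stalkIdeal_mul, hJ''ζ, hd]
  obtain ⟨U, hζU, hU, hgood⟩ := goodOver_nhd_of_locGood hNF p hp k X₁ f₁ (J₀ * J'') hprod ζ d hdζ hfull
  exact ⟨J'', U, hJ'', hJ''ζ, hζU, hU, hgood⟩

/-- (c) from the two printed openness theorems BY NAME. [OURS · conditional-result] [cite: DattaMurayama2024, Thm. B] -/
theorem exists_dominating_goodOver_nhd_of_DM_CMLocusOpen
    (hDM : Literature.AlgebraicGeometry.Resolution.DattaMurayama2024_fInjectiveLocusOpen.{0})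
    (hCMo : NonFullLocusClosed.CMLocusOpen)
    (p : ℕ) (hp : p.Prime) (k : Type) [Field k] [CharP k p] (X₁ : Scheme.{0}) (f₁ : X₁ ⟶ Spec (.of k))
    [LocallyOfFiniteType f₁] [QuasiCompact f₁] [IsIntegral X₁]
    (J₀ : X₁.IdealSheafData) (hJ₀ : J₀ ≠ ⊥) (ζ : X₁) {m : ℕ} (c : Fin m → X₁.presheaf.stalk ζ)
    (hc0 : Ideal.span (Set.range c) ≠ ⊥) {n : ℕ} (d : Fin n → X₁.presheaf.stalk ζ)
    (hd : Ideal.span (Set.range d) = stalkIdeal J₀ ζ * Ideal.span (Set.range c))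
    (hfull : ∀ (j : Fin n) (𝔔 : PrimeSpectrum (blowupAlgebra (Ideal.span (Set.range d)) (d j))),
      𝔔.asIdeal.comap (algebraMap (X₁.presheaf.stalk ζ) (blowupAlgebra (Ideal.span (Set.range d)) (d j))) =
        maximalIdeal (X₁.presheaf.stalk ζ) → FullCl p (Localization.AtPrime 𝔔.asIdeal)) :
    ∃ (J'' : X₁.IdealSheafData) (U : X₁.Opens), J'' ≠ ⊥ ∧ stalkIdeal J'' ζ = Ideal.span (Set.range c) ∧ ζ ∈ (U : Set X₁) ∧
      (∀ (X₂ : Scheme.{0}) (π : X₂ ⟶ X₁), IsBlowup π (J₀ * J'') → ∀ x : X₂, π.base x ∈ (U : Set X₁) → FullCl p (X₂.presheaf.stalk x)) ∧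
      GoodOver p X₁ (J₀ * J'') (U : Set X₁) :=
  exists_dominating_goodOver_nhd (NonFullLocusClosed.nonFullLocusClosed_of_named hDM hCMo) p hp k X₁ f₁ J₀ hJ₀ ζ c hc0 d hd hfull

end Summit.ResolutionOfSingularities.ResolutionOfSingularities.Theorems.FInjectiveMacaulayfication.DominatingLocFix

end
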